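import Summits.BirchSwinnertonDyer.Rank1Residual.GaloisImage.InertiaInvariantsFrobeniusKernel
import HarnessLib

/-!
# The away-from-`p` discrepancy "unramified vs. locally trivial", KERNEL part: `t` kills
# `ker(res : H¹(D, M) → H¹(I, M))` when `Frob − 1` hits `t · M^I`
# (crux `AnticyclotomicEisensteinDivisibility`, stmt-BirchSwinnertonDyer-20727, line `bdpline`,
# registered stub `stub_awayDiscrepancySS`; helper)

Lead seat bsd-line-sbc-p1 gen 3 (2026-08-28). The registered stub (b₁) `stub_awayDiscrepancySS` of the
line `bdpline` asks that the Pontryagin dual of the one-variable discrepancy between Greenberg–Vatsal's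
`datumStrictSelmer (ker κ₂) E[p^∞] p (bdpData v̄) ∅` (UNRAMIFIED away from `p`) and Castella's
`Sel_v̄(K_∞⁻, E[p^∞])` (locally TRIVIAL away from `p`) be `Λ`-torsion. It is killed by ONE integer; at a
place `v ∤ p` splitting completely in the tower the local discrepancy is
`H¹(D_v/I_v, E[p^∞]^{I_v}) = E[p^∞]^{I_v}/(Frob_v − 1)`, finite of bounded exponent. This file is the
group-cohomological engine:

* `nsmul_eq_zero_of_resOfLe_eq_zero_of_frobenius_generation` — the tree's injectivity engine
  `resOfLe_injective_of_frobenius_generation_of_invariants` (`res : H¹(D, M) → H¹(I, M)` injective when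
  `φ − 1` is onto `M^I`; Serre *CG* I §2.6 (b)) with the surjectivity weakened to "`φ − 1` hits
  `t · M^I`": then `t` kills `ker(res)`.
* `card_ker_nsmul_mem_range` — in a finite abelian group, `#ker f · a ∈ range f` for an endomorphism
  `f` (the image has index `#ker f`).

The arithmetic (`t = #ker(Frob − 1 | E[p^∞]^{I_v})` works at every `v ∤ p`) is the sequel
`…AwayDiscrepancyLocal.lean`. Theorems only (no definition, no named fact, no `sorry`); closes nothing by
itself. BSD is not proved by any of this.

References: J.-P. Serre, *Galois Cohomology*, I §2.6 (b), I §5.1; J. S. Milne, *Arithmetic Duality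
Theorems*, I §2 Lemma 2.10; R. Greenberg, LNM 1716 (1999), §3 Lemma 3.3 (p. 87).
-/

-- D-0017: single-problem summit, the namespace repeats the problem name by design.
set_option linter.dupNamespace false
set_option autoImplicit false

noncomputable section

open scoped Classical AddSubgroup

open NumberField IsDedekindDomain Field
open Literature.NumberTheory.EllipticCurves Literature.NumberTheory.EllipticCurves.GreenbergSelmer
  Literature.NumberTheory.EllipticCurves.GreenbergVatsal2000 Literature.NumberTheory.GaloisRepresentations
  IsDedekindDomain.HeightOneSpectrum

namespace Summit.BirchSwinnertonDyer.BirchSwinnertonDyer.Theorems.SignedBaseChangeAcDivAwayDiscrepancy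

open Summit.BirchSwinnertonDyer.Rank1Residual.X11b.AcSelmer
  Summit.BirchSwinnertonDyer.Rank1Residual.GaloisImage.InertiaDivisible

universe u

/-! ## §1 Generic: `t` kills `ker(res : H¹(D, M) → H¹(I, M))` when `φ − 1` hits `t · M^I` -/

section Generic

variable {K : Type u} [Field K]
variable {M : Type u} [AddCommGroup M] [DistribMulAction (absoluteGaloisGroup K) M]
  [TopologicalSpace M] [DiscreteTopology M]

/-- **`t · ker(res : H¹(D, M) → H¹(I, M)) = 0` from Frobenius generation.** Let `I ≤ D ≤ Γ_K` with `I`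
normalised by `D`, `φ ∈ D`, every `d ∈ D` of the form `φⁿ·i·u` (`i ∈ I`, `u ∈ U`) for EVERY open
subgroup `U ≤ Γ_K`, `M` a discrete `Γ_K`-module with continuous orbit maps, and `t : ℕ` such that for
every `m ∈ M^I` there is `b ∈ M^I` with `φ b − b = t·m`. Then every class of `H¹(D, M)` restricting to `0`
on `I` is killed by `t`: its cocycle is cohomologous to `ψ₁` VANISHING on `I`, which takes values in `M^I`;
with `φ b − b = t·ψ₁(φ)` the cocycle `t·ψ₁ − ∂b` vanishes at `φ`, on `I`, hence on `⟨φ⟩·I·(D ∩ U)` for the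
open `U` in its zero set, i.e. everywhere. (The tree's `resOfLe_injective_of_frobenius_generation_of_invariants`
is the case `t = 1`; "`ker res = M^I/(φ − 1)M^I`".)
[cite: SerreGaloisCohomology1997, I.§2.6 (b) and I.§5.1] [cite: MilneADT2006, Ch. I §2 (Lemma 2.10)] -/
theorem nsmul_eq_zero_of_resOfLe_eq_zero_of_frobenius_generation {I D : Subgroup (absoluteGaloisGroup K)}
    (hID : I ≤ D) (hnorm : ∀ d ∈ D, ∀ i ∈ I, d⁻¹ * i * d ∈ I) {φ : absoluteGaloisGroup K} (hφD : φ ∈ D)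
    (hgen : ∀ U : Subgroup (absoluteGaloisGroup K), IsOpen (U : Set (absoluteGaloisGroup K)) →
      ∀ d ∈ D, ∃ (n : ℕ) (i u : absoluteGaloisGroup K), i ∈ I ∧ u ∈ U ∧ d = φ ^ n * i * u)
    (hcont : ∀ m : M, Continuous fun g : absoluteGaloisGroup K ↦ g • m) (t : ℕ)
    (hsurj : ∀ m : M, (∀ i ∈ I, i • m = m) → ∃ b : M, (∀ i ∈ I, i • b = b) ∧ φ • b - b = t • m)
    {c : subgroupH1 D M} (hc : resOfLe M hID c = 0) : t • c = 0 := by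
  obtain ⟨ψ, rfl⟩ := oneCocycleClass_surjective _ c
  -- the restricted class is the class of the pulled-back cocycle; it is a coboundary `∂v` on `I`
  have hres : resOfLe M hID (oneCocycleClass _ ψ) = oneCocycleClass _
      (contOneCocycles.pullback (subgroupInclusion hID)
        (resHomOfEquivariant (subgroupInclusion hID) (AddMonoidHom.id M) (fun _ _ ↦ rfl)) ψ) :=
    map_oneCocycleClass _ _ _ ψ
  rw [hres, oneCocycleClass_eq_zero_iff] at hc
  obtain ⟨v, hv⟩ := hc
  have hψI : ∀ (i : absoluteGaloisGroup K) (hi : i ∈ I), ψ.1 ⟨i, hID hi⟩ = i • v - v := by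
    intro i hi
    have key := hv ⟨i, hi⟩
    rw [contOneCocycles.pullback_apply] at key
    change ψ.1 (subgroupInclusion hID ⟨i, hi⟩) = (⟨i, hi⟩ : I) • v - v at key
    have e : subgroupInclusion hID ⟨i, hi⟩ = ⟨i, hID hi⟩ := Subtype.ext rfl
    rw [e] at key
    exact key
  -- first adjustment: `ψ₁ = ψ − ∂v` vanishes on `I`
  have hcontv : Continuous fun g : D ↦ g • v := (hcont v).comp continuous_subtype_val
  set ψ₁ := ψ - cobCocycle v hcontv with hψ₁
  have hψ₁I : ∀ (i : absoluteGaloisGroup K) (hi : i ∈ I), ψ₁.1 ⟨i, hID hi⟩ = 0 := by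
    intro i hi
    rw [hψ₁, Submodule.coe_sub, ContinuousMap.sub_apply, cobCocycle_apply, hψI i hi]
    change i • v - v - (i • v - v) = 0
    rw [sub_self]
  have hmul₁ : ∀ x y : D, ψ₁.1 (x * y) = ψ₁.1 x + (x : absoluteGaloisGroup K) • ψ₁.1 y :=
    fun x y ↦ ψ₁.2 x y
  -- `ψ₁` takes values in `M^I` (cocycle identity + `I` normalised by `D`)
  have hval₁ : ∀ (d : D) (i : absoluteGaloisGroup K), i ∈ I → i • ψ₁.1 d = ψ₁.1 d := by
    intro d i hi
    have hi' : (d : absoluteGaloisGroup K)⁻¹ * i * d ∈ I := hnorm d d.2 i hi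
    have e : (⟨i, hID hi⟩ : D) * d = d * ⟨(d : absoluteGaloisGroup K)⁻¹ * i * d, hID hi'⟩ :=
      Subtype.ext (by simp only [Subgroup.coe_mul]; group)
    have h1 := hmul₁ ⟨i, hID hi⟩ d
    rw [hψ₁I i hi, zero_add] at h1
    have h2 := hmul₁ d ⟨(d : absoluteGaloisGroup K)⁻¹ * i * d, hID hi'⟩
    rw [hψ₁I _ hi', smul_zero, add_zero] at h2
    rw [e, h2] at h1
    exact h1.symm
  -- second adjustment: `b ∈ M^I` with `φ b − b = t·ψ₁(φ)`; `ψ₂ = t·ψ₁ − ∂b` vanishes at `φ` and on `I`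
  obtain ⟨b, hbI, hb⟩ := hsurj (ψ₁.1 ⟨φ, hφD⟩) (fun i hi ↦ hval₁ ⟨φ, hφD⟩ i hi)
  have hcontb : Continuous fun g : D ↦ g • b := (hcont b).comp continuous_subtype_val
  set ψ₂ := (t : ℤ) • ψ₁ - cobCocycle b hcontb with hψ₂
  have htψ : ∀ x : D, ((t : ℤ) • ψ₁).1 x = t • ψ₁.1 x := fun x ↦ by
    rw [Submodule.coe_smul, ContinuousMap.smul_apply, natCast_zsmul]
  have hψ₂φ : ψ₂.1 ⟨φ, hφD⟩ = 0 := by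
    rw [hψ₂, Submodule.coe_sub, ContinuousMap.sub_apply, cobCocycle_apply, htψ]
    change t • ψ₁.1 ⟨φ, hφD⟩ - (φ • b - b) = 0
    rw [hb, sub_self]
  have hψ₂I : ∀ (i : absoluteGaloisGroup K) (hi : i ∈ I), ψ₂.1 ⟨i, hID hi⟩ = 0 := by
    intro i hi
    rw [hψ₂, Submodule.coe_sub, ContinuousMap.sub_apply, cobCocycle_apply, htψ, hψ₁I i hi, smul_zero]
    change (0 : M) - (i • b - b) = 0
    rw [hbI i hi, sub_self, sub_zero]
  have hmul : ∀ x y : D, ψ₂.1 (x * y) = ψ₂.1 x + (x : absoluteGaloisGroup K) • ψ₂.1 y :=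
    fun x y ↦ ψ₂.2 x y
  have hpow : ∀ n : ℕ, ψ₂.1 (⟨φ, hφD⟩ ^ n) = 0 := by
    intro n
    induction n with
    | zero => rw [pow_zero]; exact contOneCocycles.apply_one ψ₂
    | succ n ih => rw [pow_succ, hmul, ih, hψ₂φ, smul_zero, add_zero]
  -- the zero set of `ψ₂` is open in `D`; it contains `D ∩ U` for an open subgroup `U ≤ Γ_K`
  have hopen : IsOpen ((fun x : D ↦ ψ₂.1 x) ⁻¹' {0}) :=
    (isOpen_discrete ({0} : Set M)).preimage ψ₂.1.continuous
  obtain ⟨V, hV, hVeq⟩ := isOpen_induced_iff.mp hopen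
  have h1V : (1 : absoluteGaloisGroup K) ∈ V := by
    have h1 : (1 : D) ∈ (fun x : D ↦ ψ₂.1 x) ⁻¹' {0} := contOneCocycles.apply_one ψ₂
    rw [← hVeq] at h1
    exact h1
  obtain ⟨F, hFfin, hFV⟩ :=
    (krullTopology_mem_nhds_one_iff K (AlgebraicClosure K) V).mp (hV.mem_nhds h1V)
  haveI := hFfin
  have hU0 : ∀ (w : absoluteGaloisGroup K) (hw : w ∈ F.fixingSubgroup) (hwD : w ∈ D),
      ψ₂.1 ⟨w, hwD⟩ = 0 := by
    intro w hw hwD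
    have h : (⟨w, hwD⟩ : D) ∈ Subtype.val ⁻¹' V := hFV hw
    rw [hVeq] at h
    exact h
  -- `ψ₂ = 0`
  have hψ₂0 : ψ₂ = 0 := by
    apply Subtype.ext
    ext d
    obtain ⟨n, i, w, hi, hw, hd⟩ :=
      hgen F.fixingSubgroup (IntermediateField.fixingSubgroup_isOpen F) d d.2
    have hwD : w ∈ D := by
      have e : w = (φ ^ n * i)⁻¹ * d := by rw [hd, inv_mul_cancel_left]
      rw [e]
      exact D.mul_mem (D.inv_mem (D.mul_mem (D.pow_mem hφD n) (hID hi))) d.2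
    have e : d = ⟨φ, hφD⟩ ^ n * ⟨i, hID hi⟩ * ⟨w, hwD⟩ :=
      Subtype.ext (by simp only [Subgroup.coe_mul, SubgroupClass.coe_pow]; exact hd)
    rw [e, hmul, hmul, hpow n, hψ₂I i hi, hU0 w hw hwD]
    simp only [smul_zero, add_zero]
    rfl
  -- classes: `t·[ψ] = t·[ψ₁] = [ψ₂] = 0`
  have hcls₁ : oneCocycleClass _ ψ₁ = oneCocycleClass _ ψ := by
    rw [hψ₁, oneCocycleClass_sub, oneCocycleClass_cobCocycle, sub_zero]
  have hcls₂ : oneCocycleClass _ ψ₂ = t • oneCocycleClass _ ψ₁ := by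
    rw [hψ₂, oneCocycleClass_sub, oneCocycleClass_cobCocycle, sub_zero, oneCocycleClass_smul,
      Nat.cast_smul_eq_nsmul]
  rw [← hcls₁, ← hcls₂, hψ₂0, oneCocycleClass_zero]

end Generic

/-! ## §2 A finite-group lemma -/

section Finite

/-- In a finite abelian group, `#ker f · a` lies in the image of an endomorphism `f` (the image has
index `#ker f`, `AddSubgroup.index_range`, and `index • a ∈` the subgroup). [folklore] -/
theorem card_ker_nsmul_mem_range {A : Type*} [AddCommGroup A] [Finite A] (f : A →+ A) (a : A) :
    Nat.card f.ker • a ∈ f.range := by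
  haveI : f.ker.FiniteIndex := AddSubgroup.finiteIndex_of_finite_quotient
  rw [← AddSubgroup.index_range]
  exact f.range.nsmul_index_mem a

end Finite


end Summit.BirchSwinnertonDyer.BirchSwinnertonDyer.Theorems.SignedBaseChangeAcDivAwayDiscrepancy

end
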